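import Literature.Geometry.Riemannian.MeanConvexFrameSum

/-!
# Comparing tangent-frame sums of a bilinear form over two nearby hyperplanes (the "help term"
# of the junction)

Topic `Geometry/Riemannian` (fact seat
`provefact-Literature.Geometry.Riemannian.LawsonMichelsohn1984_surrounding`).  Everything here
is **proved**; no definitions.

In the far zone of the junction of Lawson–Michelsohn's surrounding construction (§3) the new
hypersurface `{Φ(‖Y‖, t) = 0}` is a `C²`-small graph over the mean-convex `Σ = {t = 0}` and its
mean convexity comes from that of `Σ`: in the frame sum of `MeanConvexFermiFrameSum.frameSum_fermiFun`
this is the term `Φ_t ∑ᵢ D²t(vᵢ, vᵢ)`, a frame sum of the Hessian `β = D²t(x)` over the tangent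
hyperplane `g^⊥` of the new hypersurface, to be compared with the frame sum of `β` over the
hyperplane `n^⊥`, `n = ∇t(x)`, which near `Σ` is (up to the factor `‖∇G‖`) the mean curvature of
the level of `t` — positive by hypothesis.  This file provides the elementary comparisons:

* `abs_sum_apply_orthonormal_le` — `|∑ᵢ β(vᵢ, vᵢ)| ≤ m C` for an orthonormal `m`-frame when
  `|β(u, w)| ≤ C ‖u‖ ‖w‖`;
* `norm_normalize_sub_normalize_le` — `‖g/‖g‖ - n/‖n‖‖ ≤ 2 ‖g - n‖ / ‖n‖`;
* `sum_apply_orthonormal_ker_ge` — **the help-term comparison**: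
  `∑_{vᵢ ⊥ g} β(vᵢ, vᵢ) ≥ (∑ⱼ β(bⱼ, bⱼ) - β(n, n)/‖n‖²) - 2 C ‖g/‖g‖ - n/‖n‖‖`
  (`MeanConvexFrameSum.sum_apply_orthonormal_ker_eq` for `g`, and
  `|β(n̂, n̂) - β(ĝ, ĝ)| ≤ 2 C ‖n̂ - ĝ‖`).

## References

* H. B. Lawson, Jr., M.-L. Michelsohn, *Embedding and surrounding with positive mean curvature*,
  Invent. Math. 77 (1984), §3. [LawsonMichelsohn1984]
-/

noncomputable section

open Set Function Module
open scoped RealInnerProductSpace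

namespace Literature.Geometry.Riemannian

variable {E : Type*} [NormedAddCommGroup E] [InnerProductSpace ℝ E] [FiniteDimensional ℝ E]
  {m : ℕ}

omit [FiniteDimensional ℝ E] in
/-- A frame sum of a bounded bilinear form over an orthonormal `m`-frame is at most `m C` in
absolute value. [folklore] -/
theorem abs_sum_apply_orthonormal_le (B : E →ₗ[ℝ] E →ₗ[ℝ] ℝ) {C : ℝ}
    (hB : ∀ u w, |B u w| ≤ C * ‖u‖ * ‖w‖) {v : Fin m → E} (hv : Orthonormal ℝ v) :
    |∑ i, B (v i) (v i)| ≤ m * C := by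
  calc |∑ i, B (v i) (v i)| ≤ ∑ i, |B (v i) (v i)| := Finset.abs_sum_le_sum_abs _ _
    _ ≤ ∑ _i : Fin m, C := Finset.sum_le_sum fun i _ => by
        have := hB (v i) (v i); rw [hv.1 i, mul_one, mul_one] at this; exact this
    _ = m * C := by simp

omit [FiniteDimensional ℝ E] in
/-- `‖g/‖g‖ - n/‖n‖‖ ≤ 2 ‖g - n‖ / ‖n‖` for `g, n ≠ 0`. [folklore] -/
theorem norm_normalize_sub_normalize_le {g n : E} (hg : g ≠ 0) (hn : n ≠ 0) :
    ‖‖g‖⁻¹ • g - ‖n‖⁻¹ • n‖ ≤ 2 * ‖g - n‖ / ‖n‖ := by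
  have hgp : 0 < ‖g‖ := norm_pos_iff.2 hg
  have hnp : 0 < ‖n‖ := norm_pos_iff.2 hn
  have h1 : ‖‖g‖⁻¹ • g - ‖n‖⁻¹ • g‖ ≤ ‖g - n‖ / ‖n‖ := by
    rw [← sub_smul, norm_smul, Real.norm_eq_abs]
    have e : |‖g‖⁻¹ - ‖n‖⁻¹| * ‖g‖ = |‖n‖ - ‖g‖| / ‖n‖ := by
      rw [inv_sub_inv hgp.ne' hnp.ne', abs_div, abs_of_pos (mul_pos hgp hnp)]
      field_simp
    rw [e]
    exact div_le_div_of_nonneg_right ((abs_norm_sub_norm_le n g).trans (by rw [norm_sub_rev])) hnp.le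
  have h2 : ‖‖n‖⁻¹ • g - ‖n‖⁻¹ • n‖ = ‖g - n‖ / ‖n‖ := by
    rw [← smul_sub, norm_smul, norm_inv, norm_norm, div_eq_inv_mul]
  calc ‖‖g‖⁻¹ • g - ‖n‖⁻¹ • n‖
      ≤ ‖‖g‖⁻¹ • g - ‖n‖⁻¹ • g‖ + ‖‖n‖⁻¹ • g - ‖n‖⁻¹ • n‖ := norm_sub_le_norm_sub_add_norm_sub _ _ _
    _ ≤ ‖g - n‖ / ‖n‖ + ‖g - n‖ / ‖n‖ := add_le_add h1 h2.le
    _ = 2 * ‖g - n‖ / ‖n‖ := by ring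

omit [FiniteDimensional ℝ E] in
/-- The values of a bounded bilinear form on two unit vectors differ by at most `2 C` times their
distance. [folklore] -/
theorem abs_apply_sub_apply_le (B : E →ₗ[ℝ] E →ₗ[ℝ] ℝ) {C : ℝ}
    (hB : ∀ u w, |B u w| ≤ C * ‖u‖ * ‖w‖) {x y : E} (hx : ‖x‖ = 1) (hy : ‖y‖ = 1) :
    |B x x - B y y| ≤ 2 * C * ‖x - y‖ := by
  have e : B x x - B y y = B (x - y) x + B y (x - y) := by
    rw [map_sub, LinearMap.sub_apply, map_sub]; ring
  rw [e]
  calc |B (x - y) x + B y (x - y)| ≤ |B (x - y) x| + |B y (x - y)| := abs_add_le _ _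
    _ ≤ C * ‖x - y‖ * ‖x‖ + C * ‖y‖ * ‖x - y‖ := add_le_add (hB _ _) (hB _ _)
    _ = 2 * C * ‖x - y‖ := by rw [hx, hy]; ring

/-- **The help-term comparison.**  Let `dim E = m + 1`, `B` a bilinear form with
`|B(u, w)| ≤ C ‖u‖ ‖w‖`, `g, n ≠ 0`, and `v` an orthonormal `m`-frame of `g^⊥`.  Then
`∑ᵢ B(vᵢ, vᵢ) ≥ (∑ⱼ B(bⱼ, bⱼ) - B(n, n)/‖n‖²) - 2 C ‖g/‖g‖ - n/‖n‖‖` for every orthonormal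
basis `b` (the frame sum over `g^⊥` against the frame sum over `n^⊥`).
[cite: LawsonMichelsohn1984, §3] -/
theorem sum_apply_orthonormal_ker_ge (hE : finrank ℝ E = m + 1) (B : E →ₗ[ℝ] E →ₗ[ℝ] ℝ) {C : ℝ}
    (hB : ∀ u w, |B u w| ≤ C * ‖u‖ * ‖w‖) {ι : Type*} [Fintype ι] (b : OrthonormalBasis ι ℝ E)
    {g n : E} (hg : g ≠ 0) (hn : n ≠ 0) {v : Fin m → E} (hv : Orthonormal ℝ v)
    (hvg : ∀ i, ⟪v i, g⟫ = 0) :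
    (∑ j, B (b j) (b j) - B n n / ‖n‖ ^ 2) - 2 * C * ‖‖g‖⁻¹ • g - ‖n‖⁻¹ • n‖ ≤
      ∑ i, B (v i) (v i) := by
  rw [sum_apply_orthonormal_ker_eq hE B b hg hv hvg]
  have hgp : 0 < ‖g‖ := norm_pos_iff.2 hg
  have hnp : 0 < ‖n‖ := norm_pos_iff.2 hn
  -- `B(g, g)/‖g‖² = B(ĝ, ĝ)` and the same for `n`
  have hsq : ∀ {x : E}, x ≠ 0 → B x x / ‖x‖ ^ 2 = B (‖x‖⁻¹ • x) (‖x‖⁻¹ • x) := fun {x} hx => by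
    have hxp : 0 < ‖x‖ := norm_pos_iff.2 hx
    rw [map_smul, map_smul, LinearMap.smul_apply, smul_eq_mul, smul_eq_mul]
    field_simp
  rw [hsq hg, hsq hn]
  have hunit : ∀ {x : E}, x ≠ 0 → ‖‖x‖⁻¹ • x‖ = 1 := fun {x} hx => by
    rw [norm_smul, norm_inv, norm_norm, inv_mul_cancel₀ (norm_ne_zero_iff.2 hx)]
  have h := abs_apply_sub_apply_le B hB (hunit hn) (hunit hg)
  rw [norm_sub_rev] at h
  have := (abs_le.1 h).1
  linarith

end Literature.Geometry.Riemannian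

end
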